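import Literature.Topology.CoveringSpaces.CoveringConnectedObjects
import Literature.Topology.CoveringSpaces.CoveringGaloisCategory
import Literature.Topology.CoveringSpaces.CoveringDeckTransformations
import Literature.Topology.CoveringSpaces.CoveringNormalClosure
import Mathlib.CategoryTheory.Galois.GaloisObjects
import HarnessLib

/-!
# Galois objects of `Cov^fin(X)` are the normal (regular) covering spaces

PROOF-ONLY companion (abc-iut cell, campaign-L R1 support, GAP row G-L4t14-R1; seat abc-iut-f-072): the
second entry of the dictionary «Galois category `Cov^fin(X)` ↔ topology» ([SGA1] Exp. V §4–§5: an object is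
GALOIS iff it is connected and its automorphism group acts transitively on the fibre — Mathlib
`PreGaloisCategory.isGalois_iff_pretransitive`; Hatcher Prop. 1.39: a connected cover is NORMAL iff its deck
group acts transitively on a fibre iff `p_*π₁(E, e₀) ⊴ π₁(X, x₀)` — abc-iut-L6-t18's
`CoverDeck.forall_exists_deck_apply_eq_fibre_iff_normal`).  For `X` path connected and strongly locally
contractible, `x₀ ∈ X`, `E ∈ Cov^fin(X)`:

* `CovFin.exists_deck_of_iso` / `CovFin.exists_iso_of_deck` — automorphisms of `E` in `Cov^fin(X)` are
  exactly the deck transformations of `p_E`;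
* `CovFin.isGalois_iff_forall_exists_deck` — `E` is a GALOIS object iff its total space is path connected
  and the deck group is transitive on `p⁻¹(x₀)`;
* `CovFin.isGalois_iff_normal` — iff the total space is path connected and `p_*π₁(E, e₀)` is a NORMAL
  subgroup of `π₁(X, x₀)` (any `e₀` over `x₀`).

The Galois-category structure on `CovFin X` is a `Prop` (`CovFin.galoisCategory`); the statements take it
as an instance argument.  Theorems only; nothing here bears on [IUTchIII] Cor. 3.12.
-/

noncomputable section

open CategoryTheory CategoryTheory.Limits CategoryTheory.PreGaloisCategory

universe u

namespace Literature.Topology.CoveringSpaces.CovFin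

open Literature.AnabelianGeometry.Anabelioids
open Literature.Geometry.Kaehler.ComplexTorus (deckTransformations mem_deckTransformations_iff)

variable {X : Type u} [TopologicalSpace X] [PathConnectedSpace X] [StronglyLocallyContractibleSpace X]

omit [PathConnectedSpace X] [StronglyLocallyContractibleSpace X] in
/-- Composition in `Cov^fin(X)` on points. [cite: HatcherAT2002, §1.3 p.67] -/
theorem comp_apply {E F G : CovFin X} (f : E ⟶ F) (g : F ⟶ G) (e : E.obj.left) :
    (f ≫ g).hom.left e = g.hom.left (f.hom.left e) := rfl

omit [PathConnectedSpace X] [StronglyLocallyContractibleSpace X] in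
/-- The identity of `Cov^fin(X)` on points. [cite: HatcherAT2002, §1.3 p.67] -/
theorem id_apply (E : CovFin X) (e : E.obj.left) : (𝟙 E : E ⟶ E).hom.left e = e := rfl

omit [PathConnectedSpace X] [StronglyLocallyContractibleSpace X] in
/-- **An automorphism of `E` in `Cov^fin(X)` is a deck transformation of `p_E`** (same underlying map).
[cite: HatcherAT2002, §1.3 Prop. 1.39] -/
theorem exists_deck_of_iso (E : CovFin X) (σ : E ≅ E) :
    ∃ f ∈ deckTransformations E.proj, ∀ e, f e = σ.hom.hom.left e := by
  refine ⟨⟨⟨σ.hom.hom.left, σ.inv.hom.left, fun e => ?_, fun e => ?_⟩, continuous_hom σ.hom,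
    continuous_hom σ.inv⟩, ?_, fun e => rfl⟩
  · have h := congrArg (fun k : E ⟶ E => k.hom.left e) σ.hom_inv_id
    simpa only [comp_apply, id_apply] using h
  · have h := congrArg (fun k : E ⟶ E => k.hom.left e) σ.inv_hom_id
    simpa only [comp_apply, id_apply] using h
  · rw [mem_deckTransformations_iff]
    exact fun e => hom_over σ.hom e

omit [PathConnectedSpace X] [StronglyLocallyContractibleSpace X] in
/-- **A deck transformation of `p_E` is an automorphism of `E` in `Cov^fin(X)`.** [cite: HatcherAT2002, §1.3 Prop. 1.39] -/
theorem exists_iso_of_deck (E : CovFin X) (f : E.obj.left ≃ₜ E.obj.left)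
    (hf : f ∈ deckTransformations E.proj) : ∃ σ : E ≅ E, ∀ e, σ.hom.hom.left e = f e := by
  rw [mem_deckTransformations_iff] at hf
  have hf' : ∀ e, E.proj (f.symm e) = E.proj e := fun e => by
    conv_rhs => rw [← f.apply_symm_apply e]
    exact (hf _).symm
  refine ⟨⟨homMk f f.continuous hf, homMk f.symm f.symm.continuous hf', ?_, ?_⟩, fun e => rfl⟩
  · exact hom_ext (funext fun e => by simp)
  · exact hom_ext (funext fun e => by simp)

/-- **Galois objects of `Cov^fin(X)`**: `E` is Galois iff its total space is path connected and the deck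
group of `p_E` is transitive on the fibre `p⁻¹(x₀)`. [cite: SGA1, Exp. V §5] -/
theorem isGalois_iff_forall_exists_deck [GaloisCategory (CovFin X)] (x₀ : X) (E : CovFin X) :
    IsGalois E ↔ PathConnectedSpace E.obj.left ∧
      ∀ y y' : E.proj ⁻¹' {x₀}, ∃ f ∈ deckTransformations E.proj, f y = y' := by
  obtain ⟨hF⟩ := nonempty_fiberFunctor_fibre (X := X) x₀
  let F := fibreFunctor x₀ ⋙ Action.forget FintypeCat.{u} (FundamentalGroup X x₀)
  haveI : FiberFunctor F := hF
  -- `F.map` of a morphism of covers is the underlying map on the fibre (`CoverMorphism.fibreMap`)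
  have key : ∀ (σ : Aut E) (y : F.obj E),
      Subtype.val (F.map σ.hom y) = σ.hom.hom.left (Subtype.val y) := fun _ _ => rfl
  constructor
  · intro h
    have hc : PathConnectedSpace E.obj.left :=
      (isConnected_iff_pathConnectedSpace x₀ E).mp h.toIsConnected
    refine ⟨hc, fun y y' => ?_⟩
    obtain ⟨σ, hσ⟩ := MulAction.exists_smul_eq (Aut E) (α := F.obj E) y y'
    obtain ⟨f, hf, hfe⟩ := exists_deck_of_iso E σ
    refine ⟨f, hf, ?_⟩
    rw [hfe]
    exact (key σ y).symm.trans (congrArg Subtype.val hσ)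
  · rintro ⟨hc, h⟩
    haveI : IsConnected E := (isConnected_iff_pathConnectedSpace x₀ E).mpr hc
    refine (isGalois_iff_pretransitive F E).mpr ⟨fun y y' => ?_⟩
    obtain ⟨f, hf, hfe⟩ := h y y'
    obtain ⟨σ, hσ⟩ := exists_iso_of_deck E f hf
    exact ⟨σ, Subtype.ext ((key σ y).trans (((hσ _).trans hfe)))⟩

/-- **Galois objects of `Cov^fin(X)` = NORMAL coverings**: `E` is Galois iff its total space is path
connected and `p_*π₁(E, e₀)` is a normal subgroup of `π₁(X, x₀)` (Hatcher Prop. 1.39, through the deck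
group). [cite: HatcherAT2002, §1.3 Prop. 1.39] -/
theorem isGalois_iff_normal [GaloisCategory (CovFin X)] (x₀ : X) (E : CovFin X) (e₀ : E.proj ⁻¹' {x₀}) :
    IsGalois E ↔ PathConnectedSpace E.obj.left ∧
      (FundamentalGroup.mapOfEq ⟨E.proj, E.property.1.continuous⟩ e₀.2).range.Normal := by
  rw [isGalois_iff_forall_exists_deck x₀ E]
  haveI : LocallyPathConnectedSpace E.obj.left := locallyPathConnectedSpace_of_isCoveringMap E.property.1
  constructor
  · rintro ⟨hc, h⟩
    haveI := hc
    exact ⟨hc, (CoverDeck.forall_exists_deck_apply_eq_fibre_iff_normal E.property.1 e₀).mp h⟩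
  · rintro ⟨hc, h⟩
    haveI := hc
    exact ⟨hc, (CoverDeck.forall_exists_deck_apply_eq_fibre_iff_normal E.property.1 e₀).mpr h⟩

end Literature.Topology.CoveringSpaces.CovFin
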